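import Summits.AtomisticToContinuum.HydrodynamicLimit.Theses.ImplosionDichotomy
import Summits.AtomisticToContinuum.HydrodynamicLimit.Theses.JaynesSqueeze
import Summits.AtomisticToContinuum.HydrodynamicLimit.Theorems.DenseExcursion.Negative.Dichotomy
import Summits.AtomisticToContinuum.HydrodynamicLimit.Theorems.DiluteSelfConsistency.Negative.Tightness
import Summits.AtomisticToContinuum.HydrodynamicLimit.Theorems.ImplosionDichotomyDiluteSelfConsistencyPdeForm
import Summits.AtomisticToContinuum.HydrodynamicLimit.Theorems.ImplosionDichotomyDiluteSelfConsistencyTimeLocalisation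
import Summits.AtomisticToContinuum.HydrodynamicLimit.Theorems.TwoClocksEntropyToHydro

/-!
# `DiluteSelfConsistency` (stmt-AtomisticToContinuum-3091) — crux-strategist s1 (gen 3), seat JS (bet route JaynesSqueeze):
kernel companion of `STRATEGY-CENSUS.md` PART 0-JS (standalone copy `STRATEGY-CENSUS-s1-JS.md`)

Seat planner-cstrat-stmt-AtomisticToContinuum-3091-s1-0, 2026-08-17 (bet route `JaynesSqueeze`; the decl is shared,
`Iff.rfl`-equal copies in every wanting Theses file). NOT a skeleton (no `stub_*`, nothing offered to a lead). A sibling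
seat of the same unit (bet route TwoClocks) publishes `StrategistSketchS1.lean` (guard split / semi-uniform S⁺); this
file is disjoint from it.

* §0 the JaynesSqueeze copy is the ImplosionDichotomy copy (`Iff.rfl`), so every landed fact about the crux applies.
* §1 status of the live line's last stub: `PostWindow ↔ DSC ↔ ¬DenseExcursion` are LANDED `Iff`s — quoted by name, so
  the census's move of candidate B (time split) from column (d) to column (c) is a kernel fact, not a reading.
* §2 the BOOTSTRAP (continuity-argument) form of the crux — strengthening JS-S1 / split JS-D1 of the census:
  `DSCBootstrap` (improve `packing ≤ 2η` on `[0,t]` to `packing < η` at `t`), the two provable-now side pieces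
  `PackingContinuationPrinciple` (the abstract continuity argument for classical solutions) and `InitialPackingSmall`
  (pinned data are dilute at `t = 0`), the glue `dsc_of_bootstrap` PROVED, and the converse `dscBootstrap_of_dsc`
  PROVED — so the bootstrap form is a REFORMULATION (restated modulo two provable lemmas), recorded, not filed.
* §3 consumer-side pointer for the bet route (tenure's edit, not this seat's): the GUARDED entropy target
  `RelEntropyVanishingGuarded η₀` and the ten-line transfer `hydrodynamicLimit_of_relEntropyVanishingGuarded :
  0 < η₀ → RelEntropyVanishingGuarded η₀ → _root_.HydrodynamicLimit` PROVED — the re-typed (packing-guarded) Statement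
  is reached from a guarded Yau target WITHOUT `DiluteSelfConsistency`.
-/

noncomputable section

namespace Summit.AtomisticToContinuum.HydrodynamicLimit.Cruxes.DiluteSelfConsistency.StrategistS1JS

open MeasureTheory Filter Set Topology InformationTheory
open scoped ENNReal
open Literature.MathematicalPhysics.KineticTheory Literature.Analysis.FluidPDE Literature.Analysis.FunctionSpaces
open Summit.AtomisticToContinuum.HydrodynamicLimit.Theses.ImplosionDichotomy
open Summit.AtomisticToContinuum.HydrodynamicLimit.Theorems
open Summit.AtomisticToContinuum.HydrodynamicLimit.Theorems.DenseExcursionDichotomy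

/-! ## §0 The bet route's copy is the audited copy -/

/-- The JaynesSqueeze copy of the crux is the ImplosionDichotomy copy, definitionally. [folklore] -/
theorem jaynesSqueeze_copy_iff :
    Summit.AtomisticToContinuum.HydrodynamicLimit.Theses.JaynesSqueeze.DiluteSelfConsistency ↔
      DiluteSelfConsistency :=
  Iff.rfl

/-! ## §1 The live line's last stub IS the crux IS the sibling's negation (all landed) -/

/-- `stub_postWindowDilute` (B.2 of line `birth` rev c3) ↔ the crux: LANDED (`diluteSelfConsistency_iff_postWindow`,
p151448). Hence candidate B of the census table fails clause (c) by a landed `Iff`, exactly like A′ and E. [folklore] -/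
theorem postWindow_iff_dsc :
    (∀ η : ℝ, 0 < η → ∀ (a₀ θ₀ : T3 → ℝ) (u₀ : T3 → V3), Continuous a₀ → Continuous θ₀ → Continuous u₀ →
      (∀ x, 0 < a₀ x) → (∀ x, 0 < θ₀ x) →
      ∀ (T₁ : ℝ) (ρ₁ θ₁ : ℝ → T3 → ℝ) (u₁ : ℝ → T3 → V3), 0 < T₁ → IsHardSphereEulerSolution 0 T₁ ρ₁ u₁ θ₁ →
        (∀ x, ρ₁ 0 x = a₀ x / ∫ y, a₀ y) → u₁ 0 = u₀ → θ₁ 0 = θ₀ →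
        ∃ T₂ : ℝ, 0 < T₂ ∧ T₂ < T₁ ∧ ∃ σ₀ : ℝ, 0 < σ₀ ∧ ∀ σ : ℝ, 0 < σ → σ < σ₀ →
          ∀ (T : ℝ) (ρ θ : ℝ → T3 → ℝ) (u : ℝ → T3 → V3), IsHardSphereEulerSolution σ T ρ u θ →
            ∀ Φ : (N : ℕ) → HardSphereFlow (Torus.geometry (Fin 3)) (hsDiameter σ N) (N + 1),
              TendstoHydroFieldsAt (fun N => localGibbsLaw σ a₀ u₀ θ₀ N (Φ N)) Φ ρ u θ 0 →
                ∀ t ∈ Ico 0 T, T₂ < t → ∀ x, ρ t x * σ ^ 3 < η) ↔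
      DiluteSelfConsistency :=
  diluteSelfConsistency_iff_postWindow.symm

/-- … and the crux ↔ `¬DenseExcursion` (stmt-12586): LANDED. [folklore] -/
theorem dsc_iff_not_denseExcursion : DiluteSelfConsistency ↔ ¬ DenseExcursion :=
  not_denseExcursion_iff_diluteSelfConsistency.symm

/-! ## §2 The bootstrap (continuity-argument) form — strengthening JS-S1 / split JS-D1

The form in which any positive proof of a packing bound would actually be run: assume the bound with a factor-2 loss on
`[0, t]` and improve it at `t`. Typed in the PDE form of the crux (pinned data; `diluteSelfConsistency_iff_pde`). -/

/-- **Bootstrap form of the crux** (improvement step only): for every level and all profiles there is `σ₀` such that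
for `σ < σ₀`, along every classical σ-solution with the pinned data, `packing ≤ 2η on [0,t]` implies `packing < η at t`.
The a-priori bound it grants (`ρ ≤ 2η/σ³` on `[0,t]`) makes the equation of state uniformly `O(η)`-close to ideal and
uniformly smooth along the window — and gives NO compactness (the density bound diverges as `σ → 0`), which is why the
added rigidity buys nothing at a tuned implosion (census §Strengthen). -/
def DSCBootstrap : Prop :=
  ∀ η : ℝ, 0 < η → ∀ (a₀ θ₀ : T3 → ℝ) (u₀ : T3 → V3) (ha : Continuous a₀) (ha0 : ∀ x, 0 < a₀ x),
    Continuous θ₀ → Continuous u₀ → (∀ x, 0 < θ₀ x) →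
    ∃ σ₀ : ℝ, 0 < σ₀ ∧ ∀ σ : ℝ, 0 < σ → σ < σ₀ →
      ∀ (T : ℝ) (ρ θ : ℝ → T3 → ℝ) (u : ℝ → T3 → V3), IsHardSphereEulerSolution σ T ρ u θ →
        ρ 0 = rhoLim (profileOf a₀ ha ha0) σ → u 0 = u₀ → θ 0 = θ₀ →
          ∀ t ∈ Ico 0 T, (∀ s ∈ Icc 0 t, ∀ x, ρ s x * σ ^ 3 ≤ 2 * η) → ∀ x, ρ t x * σ ^ 3 < η

/-- **The abstract continuity argument** for classical hard-sphere Euler solutions (provable now: joint continuity of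
`ρ` on the compact slices `[0,t] × 𝕋³` from `IsSmoothSpaceTimeOn`, so `t ↦ max_x ρ(t,·)σ³` is continuous on `[0,T)`;
a continuous function that starts `< η` and satisfies "`≤ 2η` so far ⇒ `< η` now" never reaches `η`). Stated for every
fixed `σ > 0` and level; no smallness. -/
def PackingContinuationPrinciple : Prop :=
  ∀ η : ℝ, 0 < η → ∀ σ : ℝ, 0 < σ → ∀ (T : ℝ) (ρ θ : ℝ → T3 → ℝ) (u : ℝ → T3 → V3),
    IsHardSphereEulerSolution σ T ρ u θ → (∀ x, ρ 0 x * σ ^ 3 < η) →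
      (∀ t ∈ Ico 0 T, (∀ s ∈ Icc 0 t, ∀ x, ρ s x * σ ^ 3 ≤ 2 * η) → ∀ x, ρ t x * σ ^ 3 < η) →
        ∀ t ∈ Ico 0 T, ∀ x, ρ t x * σ ^ 3 < η

/-- **Pinned data are dilute at `t = 0`** (provable now: `rhoLim (profileOf a₀) σ ≤ 2·a₀/∫a₀` on the dilute branch,
`rhoLim_le_two_mul_β`, and `a₀/∫a₀` is bounded on the compact torus; then `2Bσ³ < η` for small `σ`). -/
def InitialPackingSmall : Prop :=
  ∀ η : ℝ, 0 < η → ∀ (a₀ : T3 → ℝ) (ha : Continuous a₀) (ha0 : ∀ x, 0 < a₀ x),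
    ∃ σ₀ : ℝ, 0 < σ₀ ∧ ∀ σ : ℝ, 0 < σ → σ < σ₀ → ∀ x, rhoLim (profileOf a₀ ha ha0) σ x * σ ^ 3 < η

/-- Glue of split JS-D1: continuation principle → initial diluteness → bootstrap step → the crux. PROVED (pure logic
over `diluteSelfConsistency_iff_pde`). [folklore] -/
theorem dsc_of_bootstrap (hC : PackingContinuationPrinciple) (hI : InitialPackingSmall) (hB : DSCBootstrap) :
    DiluteSelfConsistency := by
  rw [diluteSelfConsistency_iff_pde]
  intro η hη a₀ θ₀ u₀ ha ha0 hθ hu hθ0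
  obtain ⟨σ₁, hσ₁, H₁⟩ := hI η hη a₀ ha ha0
  obtain ⟨σ₂, hσ₂, H₂⟩ := hB η hη a₀ θ₀ u₀ ha ha0 hθ hu hθ0
  refine ⟨min σ₁ σ₂, lt_min hσ₁ hσ₂, ?_⟩
  intro σ hσ hσlt T ρ θ u hE h1 h2 h3
  have hσ₁' : σ < σ₁ := lt_of_lt_of_le hσlt (min_le_left _ _)
  have hσ₂' : σ < σ₂ := lt_of_lt_of_le hσlt (min_le_right _ _)
  refine hC η hη σ hσ T ρ θ u hE ?_ ?_
  · intro x
    rw [h1]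
    exact H₁ σ hσ hσ₁' x
  · intro t ht hboot
    exact H₂ σ hσ hσ₂' T ρ θ u hE h1 h2 h3 t ht hboot

/-- Converse: the crux gives the bootstrap step outright (its conclusion needs no hypothesis). So `DSCBootstrap` is the
crux REWORDED modulo the two provable side pieces — a reformulation, not a decomposition (census §Decomposition,
candidate JS-D1: clause (c) fails in substance). [folklore] -/
theorem dscBootstrap_of_dsc (hD : DiluteSelfConsistency) : DSCBootstrap := by
  rw [diluteSelfConsistency_iff_pde] at hD
  intro η hη a₀ θ₀ u₀ ha ha0 hθ hu hθ0
  obtain ⟨σ₀, hσ₀, H⟩ := hD η hη a₀ θ₀ u₀ ha ha0 hθ hu hθ0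
  exact ⟨σ₀, hσ₀, fun σ hσ hσ' T ρ θ u hE h1 h2 h3 t ht _ x => H σ hσ hσ' T ρ θ u hE h1 h2 h3 t ht x⟩

/-! ## §3 Consumer-side pointer for the bet route JaynesSqueeze (tenure's edit; recorded, not executed)

`closes` of JaynesSqueeze reaches the re-typed Statement through the UNGUARDED Yau target and
`HydrodynamicLimit.of_unguarded`, consuming `h₅ : DiluteSelfConsistency` inside `SqueezeClosure`. Since D-0032 the
packing guard is a HYPOTHESIS of `_root_.HydrodynamicLimit`; a guarded Yau target reaches it directly. -/

/-- **Guarded relative-entropy target** at packing level `η₀`: verbatim `RelEntropyVanishing` (stmt-0766) with the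
Statement's guard `∀ t ∈ [0,T), ∀ x, ρ_t(x)σ³ < η₀` inserted as a hypothesis on the classical solution. -/
def RelEntropyVanishingGuarded (η₀ : ℝ) : Prop :=
  ∀ (a₀ θ₀ : T3 → ℝ) (u₀ : T3 → V3), Continuous a₀ → Continuous θ₀ → Continuous u₀ →
    (∀ x, 0 < a₀ x) → (∀ x, 0 < θ₀ x) → ∃ σ₀ : ℝ, 0 < σ₀ ∧ ∀ σ : ℝ, 0 < σ → σ < σ₀ →
    ∀ (T : ℝ) (ρ θ : ℝ → T3 → ℝ) (u : ℝ → T3 → V3), IsHardSphereEulerSolution σ T ρ u θ →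
    (∀ t ∈ Ico 0 T, ∀ x, ρ t x * σ ^ 3 < η₀) →
    ∀ Φ : (N : ℕ) → HardSphereFlow (Torus.geometry (Fin 3)) (hsDiameter σ N) (N + 1),
    (∀ N, IsProbabilityMeasure (localGibbsLaw σ a₀ u₀ θ₀ N (Φ N))) ∧
    (TendstoHydroFieldsAt (fun N => localGibbsLaw σ a₀ u₀ θ₀ N (Φ N)) Φ ρ u θ 0 →
      ∀ t ∈ Ico 0 T, ∃ a : T3 → ℝ,
      (∀ N, IsProbabilityMeasure (localGibbsLaw σ a (u t) (θ t) N (Φ N))) ∧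
      (∀ χ : T3 → ℝ, Continuous χ → ∀ δ : ℝ, 0 < δ → ∃ C : ℝ, 0 < C ∧ ∀ N : ℕ,
        localGibbsLaw σ a (u t) (θ t) N (Φ N)
            {z | δ < |empiricalDensityField z χ - ∫ x, χ x * ρ t x|} ≤
          ENNReal.ofReal (C * Real.exp (-(C⁻¹ * (N + 1)))) ∧
        localGibbsLaw σ a (u t) (θ t) N (Φ N)
            {z | δ < ‖empiricalMomentumField z χ - ∫ x, (χ x * ρ t x) • u t x‖} ≤
          ENNReal.ofReal (C * Real.exp (-(C⁻¹ * (N + 1)))) ∧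
        localGibbsLaw σ a (u t) (θ t) N (Φ N)
            {z | δ < |empiricalEnergyField z χ -
              ∫ x, χ x * totalEnergyDensity (ρ t x) (u t x) (θ t x)|} ≤
          ENNReal.ofReal (C * Real.exp (-(C⁻¹ * (N + 1))))) ∧
      Tendsto (fun N : ℕ => klDiv ((Φ N).lawAt (localGibbsLaw σ a₀ u₀ θ₀ N (Φ N)) t)
        (localGibbsLaw σ a (u t) (θ t) N (Φ N)) / ((N : ℝ≥0∞) + 1)) atTop (𝓝 0))

/-- **Guarded Yau target ⇒ the re-typed (packing-guarded) Statement**, with `η₀` as the Statement's outer witness and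
the same `σ₀`; solution-wise `tendstoHydroFieldsAt_of_klDiv` (landed, TwoClocksEntropyToHydro). No
`DiluteSelfConsistency` anywhere. [cite: Yau1991, §2] -/
theorem hydrodynamicLimit_of_relEntropyVanishingGuarded {η₀ : ℝ} (hη₀ : 0 < η₀)
    (hRE : RelEntropyVanishingGuarded η₀) : _root_.HydrodynamicLimit := by
  refine ⟨η₀, hη₀, fun a₀ θ₀ u₀ ha hθ hu ha0 hθ0 => ?_⟩
  obtain ⟨σ₀, hσ₀, H⟩ := hRE a₀ θ₀ u₀ ha hθ hu ha0 hθ0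
  refine ⟨σ₀, hσ₀, fun σ hσ hσ' T ρ θ u hE hguard Φ h0 t ht => ?_⟩
  obtain ⟨hprob, hmain⟩ := H σ hσ hσ' T ρ θ u hE hguard Φ
  obtain ⟨a, hψ, hconc, hkl⟩ := hmain h0 t ht
  exact tendstoHydroFieldsAt_of_klDiv (a := a) Φ hconc hkl

/-- The unguarded target implies every guarded one (drop the guard), so re-docking on `RelEntropyVanishingGuarded`
loses nothing the route already had. [folklore] -/
theorem relEntropyVanishingGuarded_of_unguarded (η₀ : ℝ)
    (h : Summit.AtomisticToContinuum.HydrodynamicLimit.Theses.JaynesSqueeze.RelEntropyVanishing) :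
    RelEntropyVanishingGuarded η₀ := by
  intro a₀ θ₀ u₀ ha hθ hu ha0 hθ0
  obtain ⟨σ₀, hσ₀, H⟩ := h a₀ θ₀ u₀ ha hθ hu ha0 hθ0
  exact ⟨σ₀, hσ₀, fun σ hσ hσ' T ρ θ u hE _ Φ => H σ hσ hσ' T ρ θ u hE Φ⟩

end Summit.AtomisticToContinuum.HydrodynamicLimit.Cruxes.DiluteSelfConsistency.StrategistS1JS

end
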